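import Summits.Langlands.Langlands.Theses.EisensteinDegreeShift

/-!
# Crux `EisensteinSeededLifting` (route `EisensteinDegreeShift`, item stmt-Langlands-18369) — birth skeleton `Lines/birth.lean`

LEAD RESHAPE r1 (prover-line-stmt-Langlands-18369-0, 2026-08-17): statements UNCHANGED; the three registered
stub theorems now spell out the bodies of `Sig.stub_<name>` (definitionally equal) so that the registered
signature of each stub is the literal Prop a `Theorems/… --supports stmt-Langlands-18369` file states
(`Lines/` is never importable, so `Sig.stub_<name>` cannot be the landed statement).
LEAD RESHAPE r2: the `let D := …` / `letI := D.algebra` / `let M := …` binders of `Sig.stub_conjInvariance` and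
`Sig.stub_liftingFlatTarget` are expanded (the registry truncates a signature at its first `:=`); in
`stub_conjInvariance` the labelled-weights clause now ranges over ALL ring homs `τ : K_v →+* ℚ̄_p` (a
harmless strengthening: frame invariance holds label by label); `stub_liftingFlatTarget` keeps the crux's
`ℚ_p`-algebra homs via an explicit `@AlgHom … D.algebra _` binder (statement definitionally unchanged).

Skeleton registrar (BC3), shape D-0027 §3.3: three precise stub statements `Sig.stub_<name> : Prop`, the
registered stubs `theorem stub_<name> : Sig.stub_<name> := by sorry` (the ONLY `sorry`s of the file), the
kernel-checked composition `EisensteinSeededLifting_of : Sig.stub_residualFlattening → Sig.stub_conjInvariance →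
Sig.stub_liftingFlatTarget → EisensteinSeededLifting` (no `sorry` of its own), and the skeleton theorem
`EisensteinSeededLifting_proof : EisensteinSeededLifting := EisensteinSeededLifting_of stub_… stub_… stub_…`
(concludes the crux BY NAME; depends on `sorryAx` only through the three stubs).

THE CUT.  The crux is frame-rigid (`HasUpperTriangularIntegralModel ρ ρ₀` pins `ρ₀ = ρ` entrywise) and its
coefficient ring `O` is the valuation ring of `ℚ̄_p` (NON-discrete value group `p^ℚ`).  Over such an `O`
the residual EXTENSION data of a residually upper-triangular model carries no invariant information:
conjugating by the fractional diagonal frame `P = diag(λ^{n-1}, …, λ, 1)` with `c < |λ|^{n-1} < 1`,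
`c := sup_g max_{i>j} |(ρ₀ g)_{ij}| < 1` (compactness of `Γ_K`, continuity of `ρ`), multiplies the
`(i,j)` entry by `λ^{j-i}`: entries above the diagonal land in `𝔪`, entries below stay in `𝔪`, the
diagonal is unchanged — the conjugate model is residually SPLIT `χ̄₁ ⊕ ⋯ ⊕ χ̄ₙ`
(`stub_residualFlattening`, valuation theory only).  All sector hypotheses and the Satake conclusion are
frame-invariants (`stub_conjInvariance`: irreducibility, unramifiedness — `isUnramifiedAt_conj_iff` —,
`IsCrystallineFramed` — `HasQlModel` absorbs the frame, `PstWeilDeligneData.conj` —, the labelled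
Hodge–Tate multisets — `labelD`/`labelFilD` transported along `P ⊗ 1` —, and `SatakeFrobCompatibleAt` —
characteristic polynomials), and the seed's diagonal congruence is transitive along the flattening.  Hence
the crux REDUCES to its residually-split-target case `stub_liftingFlatTarget` (the crux with the extra
hypothesis `∀ g, ∀ i ≠ j, (ρ₀ g)_{ij} ∈ 𝔪`), which is exactly the form the intended method addresses: a
big `R^{ps} = 𝕋_𝔪` theorem at the Eisenstein maximal ideal of the residual PSEUDOCHARACTER `χ̄₁ + ⋯ + χ̄ₙ`
(Wake–Wang-Erickson / AHTW arXiv:2607.11763 §3 pseudodeformation rings with p-adic Hodge conditions,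
Calegari–Geraghty/ACC+ patching of complexes fed by AHTW Prop. 5.2.8, Thorne's Steinberg seed, Ihara
avoidance at `v₀`) — a method that never sees the frame.  The split form makes that explicit and removes
the spurious "extension-class transport" sub-problem (route header, TWO-LAYER PLAN (i)) from the line.

Stubs: `stub_residualFlattening` (M, valuation-theoretic, provable now) · `stub_conjInvariance`
(M, frame-invariance package, provable now) · `stub_liftingFlatTarget` (open-problem: the R^ps = T content;
a STRICT SPECIAL CASE of the crux, so implied by it and by the summit).  Hardest: `stub_liftingFlatTarget`.
-/

namespace Summit.Langlands.Langlands.Cruxes.EisensteinSeededLifting.Birth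

open scoped MatrixGroups

/-! ## Stub statements (`Sig.stub_<name> : Prop`) and registered stubs (`theorem stub_<name>`, the only `sorry`s) -/

/-- **Residual flattening over `𝒪_{ℚ̄_p}`** (valuation theory; size M).  For the valuation ring `O`
of `ℚ̄_p` and any residually upper-triangular integral model `ρ₀` of `ρ : Γ_K →ₜ* GL_n(ℚ̄_p)` (same frame),
there is a change of frame `P ∈ GL_n(ℚ̄_p)` such that `ρ' := P ρ P⁻¹` has an integral model `ρ₀'` in ITS frame
which is residually DIAGONAL (all off-diagonal entries in `𝔪`) with the same residual diagonal entries as `ρ₀`.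
Proof sketch: `c := sup_g max_{i>j} ‖(ρ₀ g)ᵢⱼ‖ < 1` (continuous image of compact `Γ_K` inside `𝔪 = {‖x‖ < 1}`),
pick `λ ∈ ℚ̄_p` with `c < ‖λ‖^(n-1) < 1` (value group `p^ℚ` is dense: `λ = p^(1/m)`), `P := diag(λ^(n-1), …, λ, 1)`,
so `(P M P⁻¹)ᵢⱼ = λ^(j-i) Mᵢⱼ`.  Why it is not the crux: no automorphy, no number theory. -/
def Sig.stub_residualFlattening : Prop :=
    ∀ (K : Type) [Field K] [NumberField K] (n : ℕ) (p : ℕ) [Fact p.Prime]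
      (O : ValuationSubring (PadicAlgCl p)), O = (Valued.v : Valuation (PadicAlgCl p) NNReal).valuationSubring →
      ∀ (ρ : Literature.NumberTheory.GaloisRepresentations.FramedGaloisRep K (PadicAlgCl p) n) (ρ₀ : Field.absoluteGaloisGroup K →* GL (Fin n) O), ρ.HasUpperTriangularIntegralModel ρ₀ →
      ∃ (P : GL (Fin n) (PadicAlgCl p)) (ρ' : Literature.NumberTheory.GaloisRepresentations.FramedGaloisRep K (PadicAlgCl p) n) (ρ₀' : Field.absoluteGaloisGroup K →* GL (Fin n) O),
        ρ' = Literature.NumberTheory.GaloisRepresentations.FramedRep.conj P ρ ∧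
        ρ'.HasUpperTriangularIntegralModel ρ₀' ∧
        (∀ (g : Field.absoluteGaloisGroup K) (i j : Fin n), i ≠ j → (ρ₀' g).val i j ∈ IsLocalRing.maximalIdeal O) ∧
        (∀ (g : Field.absoluteGaloisGroup K) (i : Fin n), ((ρ₀' g).val i i - (ρ₀ g).val i i : O) ∈ IsLocalRing.maximalIdeal O)

/-- Registered stub `stub_residualFlattening` — statement = the body of `Sig.stub_residualFlattening` spelled out
(so that the registered signature is the literal Prop a `--supports` file proves; docstring above). -/
theorem stub_residualFlattening :
    ∀ (K : Type) [Field K] [NumberField K] (n : ℕ) (p : ℕ) [Fact p.Prime]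
      (O : ValuationSubring (PadicAlgCl p)), O = (Valued.v : Valuation (PadicAlgCl p) NNReal).valuationSubring →
      ∀ (ρ : Literature.NumberTheory.GaloisRepresentations.FramedGaloisRep K (PadicAlgCl p) n) (ρ₀ : Field.absoluteGaloisGroup K →* GL (Fin n) O), ρ.HasUpperTriangularIntegralModel ρ₀ →
      ∃ (P : GL (Fin n) (PadicAlgCl p)) (ρ' : Literature.NumberTheory.GaloisRepresentations.FramedGaloisRep K (PadicAlgCl p) n) (ρ₀' : Field.absoluteGaloisGroup K →* GL (Fin n) O),
        ρ' = Literature.NumberTheory.GaloisRepresentations.FramedRep.conj P ρ ∧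
        ρ'.HasUpperTriangularIntegralModel ρ₀' ∧
        (∀ (g : Field.absoluteGaloisGroup K) (i j : Fin n), i ≠ j → (ρ₀' g).val i j ∈ IsLocalRing.maximalIdeal O) ∧
        (∀ (g : Field.absoluteGaloisGroup K) (i : Fin n), ((ρ₀' g).val i i - (ρ₀ g).val i i : O) ∈ IsLocalRing.maximalIdeal O) := by
  sorry

/-- **Frame invariance of the sector hypotheses and of the Satake conclusion** (size M).  For
`ρ' = P ρ P⁻¹` (`FramedRep.conj`): irreducibility transfers (the linear automorphism `v ↦ P v` intertwines
the two representations on `ℚ̄_pⁿ`); unramifiedness transfers (`FramedGaloisRep.isUnramifiedAt_conj_iff`);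
at `v ∣ p`, `IsCrystallineFramed` for Fontaine's pinned datum transfers (`HasQlModel` is defined up to
`FramedRep.conj`, and `PstWeilDeligneData.conj` moves `IsWeilDeligneOf`; `toLocal ∘ conj = conj ∘ toLocal`
definitionally) and the `τ`-labelled Hodge–Tate multisets agree (`labelFilD` of isomorphic `E`-linear
representations have equal `finrank`: transport along `P ⊗ 1` on `ℚ̄_pⁿ ⊗ B`); Satake–Frobenius
compatibility descends from `ρ'` to `ρ` (`HasFrobCharpolyAt` is a characteristic polynomial,
`Matrix.charpoly` is conjugation invariant; unramifiedness as above).  Why it is not the crux: pure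
representation-theoretic bookkeeping of the accepted interfaces, no lifting. -/
def Sig.stub_conjInvariance : Prop :=
    ∀ (K : Type) [Field K] [NumberField K] (n : ℕ) (p : ℕ) [Fact p.Prime]
      (hcpt : Literature.NumberTheory.Automorphic.isCompact_glFiniteIntegralLevel n K) (ι : PadicAlgCl p ≃+* ℂ)
      (ρ ρ' : Literature.NumberTheory.GaloisRepresentations.FramedGaloisRep K (PadicAlgCl p) n) (P : GL (Fin n) (PadicAlgCl p)),
      ρ' = Literature.NumberTheory.GaloisRepresentations.FramedRep.conj P ρ →
      (ρ.toGaloisRep.IsIrreducible → ρ'.toGaloisRep.IsIrreducible) ∧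
      (∀ v : IsDedekindDomain.HeightOneSpectrum (NumberField.RingOfIntegers K), ρ.IsUnramifiedAt v → ρ'.IsUnramifiedAt v) ∧
      (∀ (v : IsDedekindDomain.HeightOneSpectrum (NumberField.RingOfIntegers K)) (hv : ((p : ℕ) : NumberField.RingOfIntegers K) ∈ v.asIdeal),
        ((Literature.NumberTheory.PAdicHodge.fontainePstAdicCompletion v p hv).IsCrystallineFramed (ρ.toLocal v) → (Literature.NumberTheory.PAdicHodge.fontainePstAdicCompletion v p hv).IsCrystallineFramed (ρ'.toLocal v)) ∧
        (∀ τ : v.adicCompletion K →+* PadicAlgCl p,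
          ρ'.labelledHodgeTateWeightsAt v (Literature.NumberTheory.PAdicHodge.fontainePstAdicCompletion v p hv).algebra (Literature.NumberTheory.PAdicHodge.fontainePstAdicCompletion v p hv).𝔅 τ = ρ.labelledHodgeTateWeightsAt v (Literature.NumberTheory.PAdicHodge.fontainePstAdicCompletion v p hv).algebra (Literature.NumberTheory.PAdicHodge.fontainePstAdicCompletion v p hv).𝔅 τ)) ∧
      (∀ (π : Literature.NumberTheory.Automorphic.CuspidalAutomorphicRepData n K hcpt) (v : IsDedekindDomain.HeightOneSpectrum (NumberField.RingOfIntegers K)), Summit.Langlands.SatakeFrobCompatibleAt ι π.1 ρ' v → Summit.Langlands.SatakeFrobCompatibleAt ι π.1 ρ v)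

/-- Registered stub `stub_conjInvariance` — statement = the body of `Sig.stub_conjInvariance` spelled out (docstring above). -/
theorem stub_conjInvariance :
    ∀ (K : Type) [Field K] [NumberField K] (n : ℕ) (p : ℕ) [Fact p.Prime]
      (hcpt : Literature.NumberTheory.Automorphic.isCompact_glFiniteIntegralLevel n K) (ι : PadicAlgCl p ≃+* ℂ)
      (ρ ρ' : Literature.NumberTheory.GaloisRepresentations.FramedGaloisRep K (PadicAlgCl p) n) (P : GL (Fin n) (PadicAlgCl p)),
      ρ' = Literature.NumberTheory.GaloisRepresentations.FramedRep.conj P ρ →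
      (ρ.toGaloisRep.IsIrreducible → ρ'.toGaloisRep.IsIrreducible) ∧
      (∀ v : IsDedekindDomain.HeightOneSpectrum (NumberField.RingOfIntegers K), ρ.IsUnramifiedAt v → ρ'.IsUnramifiedAt v) ∧
      (∀ (v : IsDedekindDomain.HeightOneSpectrum (NumberField.RingOfIntegers K)) (hv : ((p : ℕ) : NumberField.RingOfIntegers K) ∈ v.asIdeal),
        ((Literature.NumberTheory.PAdicHodge.fontainePstAdicCompletion v p hv).IsCrystallineFramed (ρ.toLocal v) → (Literature.NumberTheory.PAdicHodge.fontainePstAdicCompletion v p hv).IsCrystallineFramed (ρ'.toLocal v)) ∧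
        (∀ τ : v.adicCompletion K →+* PadicAlgCl p,
          ρ'.labelledHodgeTateWeightsAt v (Literature.NumberTheory.PAdicHodge.fontainePstAdicCompletion v p hv).algebra (Literature.NumberTheory.PAdicHodge.fontainePstAdicCompletion v p hv).𝔅 τ = ρ.labelledHodgeTateWeightsAt v (Literature.NumberTheory.PAdicHodge.fontainePstAdicCompletion v p hv).algebra (Literature.NumberTheory.PAdicHodge.fontainePstAdicCompletion v p hv).𝔅 τ)) ∧
      (∀ (π : Literature.NumberTheory.Automorphic.CuspidalAutomorphicRepData n K hcpt) (v : IsDedekindDomain.HeightOneSpectrum (NumberField.RingOfIntegers K)), Summit.Langlands.SatakeFrobCompatibleAt ι π.1 ρ' v → Summit.Langlands.SatakeFrobCompatibleAt ι π.1 ρ v) := by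
  sorry

/-- **Eisenstein-seeded lifting for a residually SPLIT-framed target** (the load-bearing stub; open-problem
grade, the `R^ps = 𝕋_𝔪` content of the line).  Verbatim the crux `EisensteinSeededLifting` with ONE extra
hypothesis on the target's integral model: `∀ g, ∀ i ≠ j, (ρ₀ g)ᵢⱼ ∈ 𝔪` (the reduction of `ρ₀` is the split
`χ̄₁ ⊕ ⋯ ⊕ χ̄ₙ`).  The seed is unchanged (cuspidal `π₀`, irreducible avatar `ρ₁` with a residually
upper-triangular model of the same residual diagonal, same labelled weights, Steinberg type at `v₀`).
Intended proof: pseudodeformation ring of the residual pseudocharacter `χ̄₁ + ⋯ + χ̄ₙ` with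
Fontaine–Laffaille condition (WWE2021, AHTW26 §3) → patched comparison with the Eisenstein-localised Hecke
algebra of the GL_n/K arithmetic locally symmetric space (CG2017/ACC+23 patching of complexes in degrees
[q₀, q₀+l₀], Galois input AHTW26 Prop. 5.2.8 at the Eisenstein 𝔪 of the seed) → the Steinberg seed forces
the characteristic-0 point of `ρ` off the reducible locus (Thorne2015/ANT2020 mechanism) with Ihara avoidance
at `v₀` → `tr ρ` is the pseudocharacter of a cuspidal `π`, and irreducibility of `ρ` gives Satake a.e.
A strict special case of the crux (hence implied by the summit): not cheaply equivalent to it — the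
reduction is `stub_residualFlattening` + `stub_conjInvariance`. -/
def Sig.stub_liftingFlatTarget : Prop :=
    ∀ (K : Type) [Field K] [NumberField K], NumberField.IsCMField K → ∀ (n : ℕ), 2 ≤ n →
      ∀ (p : ℕ) [Fact p.Prime], n < p →
      (∀ v : IsDedekindDomain.HeightOneSpectrum (NumberField.RingOfIntegers K), ((p : ℕ) : NumberField.RingOfIntegers K) ∈ v.asIdeal → ¬ v.asIdeal ^ 2 ∣ Ideal.span {((p : ℕ) : NumberField.RingOfIntegers K)}) →
      ∀ (O : ValuationSubring (PadicAlgCl p)), O = (Valued.v : Valuation (PadicAlgCl p) NNReal).valuationSubring →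
      ∀ (hcpt : Literature.NumberTheory.Automorphic.isCompact_glFiniteIntegralLevel n K) (ι : PadicAlgCl p ≃+* ℂ)
        (ρ : Literature.NumberTheory.GaloisRepresentations.FramedGaloisRep K (PadicAlgCl p) n) (ρ₀ : Field.absoluteGaloisGroup K →* GL (Fin n) O),
      ρ.toGaloisRep.IsIrreducible →
      (∀ᶠ v : IsDedekindDomain.HeightOneSpectrum (NumberField.RingOfIntegers K) in Filter.cofinite, ρ.IsUnramifiedAt v) →
      ρ.HasUpperTriangularIntegralModel ρ₀ →
      (∀ (g : Field.absoluteGaloisGroup K) (i j : Fin n), i ≠ j → (ρ₀ g).val i j ∈ IsLocalRing.maximalIdeal O) →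
      (∀ (v : IsDedekindDomain.HeightOneSpectrum (NumberField.RingOfIntegers K)) (hv : ((p : ℕ) : NumberField.RingOfIntegers K) ∈ v.asIdeal),
        (Literature.NumberTheory.PAdicHodge.fontainePstAdicCompletion v p hv).IsCrystallineFramed (ρ.toLocal v) ∧
        ∀ τ : @AlgHom ℚ_[p] (v.adicCompletion K) (PadicAlgCl p) _ _ _ (Literature.NumberTheory.PAdicHodge.fontainePstAdicCompletion v p hv).algebra _,
          (ρ.labelledHodgeTateWeightsAt v (Literature.NumberTheory.PAdicHodge.fontainePstAdicCompletion v p hv).algebra (Literature.NumberTheory.PAdicHodge.fontainePstAdicCompletion v p hv).𝔅 (@AlgHom.toRingHom ℚ_[p] (v.adicCompletion K) (PadicAlgCl p) _ _ _ (Literature.NumberTheory.PAdicHodge.fontainePstAdicCompletion v p hv).algebra _ τ)).Nodup ∧ Multiset.card (ρ.labelledHodgeTateWeightsAt v (Literature.NumberTheory.PAdicHodge.fontainePstAdicCompletion v p hv).algebra (Literature.NumberTheory.PAdicHodge.fontainePstAdicCompletion v p hv).𝔅 (@AlgHom.toRingHom ℚ_[p] (v.adicCompletion K) (PadicAlgCl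 p) _ _ _ (Literature.NumberTheory.PAdicHodge.fontainePstAdicCompletion v p hv).algebra _ τ)) = n ∧
          ∀ a ∈ ρ.labelledHodgeTateWeightsAt v (Literature.NumberTheory.PAdicHodge.fontainePstAdicCompletion v p hv).algebra (Literature.NumberTheory.PAdicHodge.fontainePstAdicCompletion v p hv).𝔅 (@AlgHom.toRingHom ℚ_[p] (v.adicCompletion K) (PadicAlgCl p) _ _ _ (Literature.NumberTheory.PAdicHodge.fontainePstAdicCompletion v p hv).algebra _ τ), ∀ b ∈ ρ.labelledHodgeTateWeightsAt v (Literature.NumberTheory.PAdicHodge.fontainePstAdicCompletion v p hv).algebra (Literature.NumberTheory.PAdicHodge.fontainePstAdicCompletion v p hv).𝔅 (@AlgHom.toRingHom ℚ_[p] (v.adicCompletion K) (PadicAlgCl p) _ _ _ (Literature.NumberTheory.PAdicHodge.fontainePstAdicCompletion v p hv).algebra _ τ), a - b ≤ (p : ℤ) - 2) →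
      (∃ v₀ : IsDedekindDomain.HeightOneSpectrum (NumberField.RingOfIntegers K), ((p : ℕ) : NumberField.RingOfIntegers K) ∉ v₀.asIdeal ∧ ρ.IsUnramifiedAt v₀ ∧
        ∃ (π₀ : Literature.NumberTheory.Automorphic.CuspidalAutomorphicRepData n K hcpt) (ρ₁ : Literature.NumberTheory.GaloisRepresentations.FramedGaloisRep K (PadicAlgCl p) n) (ρ₁₀ : Field.absoluteGaloisGroup K →* GL (Fin n) O),
          π₀.1.IsLAlgebraic ∧
          (∀ᶠ v : IsDedekindDomain.HeightOneSpectrum (NumberField.RingOfIntegers K) in Filter.cofinite, Summit.Langlands.SatakeFrobCompatibleAt ι π₀.1 ρ₁ v) ∧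
          ρ₁.toGaloisRep.IsIrreducible ∧ ρ₁.HasUpperTriangularIntegralModel ρ₁₀ ∧
          (∀ (g : Field.absoluteGaloisGroup K) (i : Fin n), ((ρ₁₀ g).val i i - (ρ₀ g).val i i : O) ∈ IsLocalRing.maximalIdeal O) ∧
          (∀ (v : IsDedekindDomain.HeightOneSpectrum (NumberField.RingOfIntegers K)) (hv : ((p : ℕ) : NumberField.RingOfIntegers K) ∈ v.asIdeal),
            (Literature.NumberTheory.PAdicHodge.fontainePstAdicCompletion v p hv).IsCrystallineFramed (ρ₁.toLocal v) ∧
            ∀ τ : @AlgHom ℚ_[p] (v.adicCompletion K) (PadicAlgCl p) _ _ _ (Literature.NumberTheory.PAdicHodge.fontainePstAdicCompletion v p hv).algebra _,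
              ρ₁.labelledHodgeTateWeightsAt v (Literature.NumberTheory.PAdicHodge.fontainePstAdicCompletion v p hv).algebra (Literature.NumberTheory.PAdicHodge.fontainePstAdicCompletion v p hv).𝔅 (@AlgHom.toRingHom ℚ_[p] (v.adicCompletion K) (PadicAlgCl p) _ _ _ (Literature.NumberTheory.PAdicHodge.fontainePstAdicCompletion v p hv).algebra _ τ) = ρ.labelledHodgeTateWeightsAt v (Literature.NumberTheory.PAdicHodge.fontainePstAdicCompletion v p hv).algebra (Literature.NumberTheory.PAdicHodge.fontainePstAdicCompletion v p hv).𝔅 (@AlgHom.toRingHom ℚ_[p] (v.adicCompletion K) (PadicAlgCl p) _ _ _ (Literature.NumberTheory.PAdicHodge.fontainePstAdicCompletion v p hv).algebra _ τ)) ∧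
          ∃ r : Literature.NumberTheory.GaloisRepresentations.WeilDeligneRep (v₀.adicCompletion K) (PadicAlgCl p) (Fin n → PadicAlgCl p),
            Literature.NumberTheory.GaloisRepresentations.IsWeilDeligneOfLadic (ρ₁.toLocal v₀).toWeilGroupHom r ∧ r.N ^ (n - 1) ≠ 0) →
      ∃ π : Literature.NumberTheory.Automorphic.CuspidalAutomorphicRepData n K hcpt, π.1.IsLAlgebraic ∧
        ∀ᶠ v : IsDedekindDomain.HeightOneSpectrum (NumberField.RingOfIntegers K) in Filter.cofinite, Summit.Langlands.SatakeFrobCompatibleAt ι π.1 ρ v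

/-- Registered stub `stub_liftingFlatTarget` — statement = the body of `Sig.stub_liftingFlatTarget` spelled out (docstring above). -/
theorem stub_liftingFlatTarget :
    ∀ (K : Type) [Field K] [NumberField K], NumberField.IsCMField K → ∀ (n : ℕ), 2 ≤ n →
      ∀ (p : ℕ) [Fact p.Prime], n < p →
      (∀ v : IsDedekindDomain.HeightOneSpectrum (NumberField.RingOfIntegers K), ((p : ℕ) : NumberField.RingOfIntegers K) ∈ v.asIdeal → ¬ v.asIdeal ^ 2 ∣ Ideal.span {((p : ℕ) : NumberField.RingOfIntegers K)}) →
      ∀ (O : ValuationSubring (PadicAlgCl p)), O = (Valued.v : Valuation (PadicAlgCl p) NNReal).valuationSubring →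
      ∀ (hcpt : Literature.NumberTheory.Automorphic.isCompact_glFiniteIntegralLevel n K) (ι : PadicAlgCl p ≃+* ℂ)
        (ρ : Literature.NumberTheory.GaloisRepresentations.FramedGaloisRep K (PadicAlgCl p) n) (ρ₀ : Field.absoluteGaloisGroup K →* GL (Fin n) O),
      ρ.toGaloisRep.IsIrreducible →
      (∀ᶠ v : IsDedekindDomain.HeightOneSpectrum (NumberField.RingOfIntegers K) in Filter.cofinite, ρ.IsUnramifiedAt v) →
      ρ.HasUpperTriangularIntegralModel ρ₀ →
      (∀ (g : Field.absoluteGaloisGroup K) (i j : Fin n), i ≠ j → (ρ₀ g).val i j ∈ IsLocalRing.maximalIdeal O) →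
      (∀ (v : IsDedekindDomain.HeightOneSpectrum (NumberField.RingOfIntegers K)) (hv : ((p : ℕ) : NumberField.RingOfIntegers K) ∈ v.asIdeal),
        (Literature.NumberTheory.PAdicHodge.fontainePstAdicCompletion v p hv).IsCrystallineFramed (ρ.toLocal v) ∧
        ∀ τ : @AlgHom ℚ_[p] (v.adicCompletion K) (PadicAlgCl p) _ _ _ (Literature.NumberTheory.PAdicHodge.fontainePstAdicCompletion v p hv).algebra _,
          (ρ.labelledHodgeTateWeightsAt v (Literature.NumberTheory.PAdicHodge.fontainePstAdicCompletion v p hv).algebra (Literature.NumberTheory.PAdicHodge.fontainePstAdicCompletion v p hv).𝔅 (@AlgHom.toRingHom ℚ_[p] (v.adicCompletion K) (PadicAlgCl p) _ _ _ (Literature.NumberTheory.PAdicHodge.fontainePstAdicCompletion v p hv).algebra _ τ)).Nodup ∧ Multiset.card (ρ.labelledHodgeTateWeightsAt v (Literature.NumberTheory.PAdicHodge.fontainePstAdicCompletion v p hv).algebra (Literature.NumberTheory.PAdicHodge.fontainePstAdicCompletion v p hv).𝔅 (@AlgHom.toRingHom ℚ_[p] (v.adicCompletion K) (PadicAlgCl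 p) _ _ _ (Literature.NumberTheory.PAdicHodge.fontainePstAdicCompletion v p hv).algebra _ τ)) = n ∧
          ∀ a ∈ ρ.labelledHodgeTateWeightsAt v (Literature.NumberTheory.PAdicHodge.fontainePstAdicCompletion v p hv).algebra (Literature.NumberTheory.PAdicHodge.fontainePstAdicCompletion v p hv).𝔅 (@AlgHom.toRingHom ℚ_[p] (v.adicCompletion K) (PadicAlgCl p) _ _ _ (Literature.NumberTheory.PAdicHodge.fontainePstAdicCompletion v p hv).algebra _ τ), ∀ b ∈ ρ.labelledHodgeTateWeightsAt v (Literature.NumberTheory.PAdicHodge.fontainePstAdicCompletion v p hv).algebra (Literature.NumberTheory.PAdicHodge.fontainePstAdicCompletion v p hv).𝔅 (@AlgHom.toRingHom ℚ_[p] (v.adicCompletion K) (PadicAlgCl p) _ _ _ (Literature.NumberTheory.PAdicHodge.fontainePstAdicCompletion v p hv).algebra _ τ), a - b ≤ (p : ℤ) - 2) →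
      (∃ v₀ : IsDedekindDomain.HeightOneSpectrum (NumberField.RingOfIntegers K), ((p : ℕ) : NumberField.RingOfIntegers K) ∉ v₀.asIdeal ∧ ρ.IsUnramifiedAt v₀ ∧
        ∃ (π₀ : Literature.NumberTheory.Automorphic.CuspidalAutomorphicRepData n K hcpt) (ρ₁ : Literature.NumberTheory.GaloisRepresentations.FramedGaloisRep K (PadicAlgCl p) n) (ρ₁₀ : Field.absoluteGaloisGroup K →* GL (Fin n) O),
          π₀.1.IsLAlgebraic ∧
          (∀ᶠ v : IsDedekindDomain.HeightOneSpectrum (NumberField.RingOfIntegers K) in Filter.cofinite, Summit.Langlands.SatakeFrobCompatibleAt ι π₀.1 ρ₁ v) ∧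
          ρ₁.toGaloisRep.IsIrreducible ∧ ρ₁.HasUpperTriangularIntegralModel ρ₁₀ ∧
          (∀ (g : Field.absoluteGaloisGroup K) (i : Fin n), ((ρ₁₀ g).val i i - (ρ₀ g).val i i : O) ∈ IsLocalRing.maximalIdeal O) ∧
          (∀ (v : IsDedekindDomain.HeightOneSpectrum (NumberField.RingOfIntegers K)) (hv : ((p : ℕ) : NumberField.RingOfIntegers K) ∈ v.asIdeal),
            (Literature.NumberTheory.PAdicHodge.fontainePstAdicCompletion v p hv).IsCrystallineFramed (ρ₁.toLocal v) ∧
            ∀ τ : @AlgHom ℚ_[p] (v.adicCompletion K) (PadicAlgCl p) _ _ _ (Literature.NumberTheory.PAdicHodge.fontainePstAdicCompletion v p hv).algebra _,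
              ρ₁.labelledHodgeTateWeightsAt v (Literature.NumberTheory.PAdicHodge.fontainePstAdicCompletion v p hv).algebra (Literature.NumberTheory.PAdicHodge.fontainePstAdicCompletion v p hv).𝔅 (@AlgHom.toRingHom ℚ_[p] (v.adicCompletion K) (PadicAlgCl p) _ _ _ (Literature.NumberTheory.PAdicHodge.fontainePstAdicCompletion v p hv).algebra _ τ) = ρ.labelledHodgeTateWeightsAt v (Literature.NumberTheory.PAdicHodge.fontainePstAdicCompletion v p hv).algebra (Literature.NumberTheory.PAdicHodge.fontainePstAdicCompletion v p hv).𝔅 (@AlgHom.toRingHom ℚ_[p] (v.adicCompletion K) (PadicAlgCl p) _ _ _ (Literature.NumberTheory.PAdicHodge.fontainePstAdicCompletion v p hv).algebra _ τ)) ∧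
          ∃ r : Literature.NumberTheory.GaloisRepresentations.WeilDeligneRep (v₀.adicCompletion K) (PadicAlgCl p) (Fin n → PadicAlgCl p),
            Literature.NumberTheory.GaloisRepresentations.IsWeilDeligneOfLadic (ρ₁.toLocal v₀).toWeilGroupHom r ∧ r.N ^ (n - 1) ≠ 0) →
      ∃ π : Literature.NumberTheory.Automorphic.CuspidalAutomorphicRepData n K hcpt, π.1.IsLAlgebraic ∧
        ∀ᶠ v : IsDedekindDomain.HeightOneSpectrum (NumberField.RingOfIntegers K) in Filter.cofinite, Summit.Langlands.SatakeFrobCompatibleAt ι π.1 ρ v := by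
  sorry

/-! ## Composition (sorry-free) and the skeleton theorem -/

/-- **Composition** (kernel-checked, no `sorry`): flatten the target's frame (`stub_residualFlattening`),
move every sector hypothesis to the flattened frame and re-aim the seed at it (`stub_conjInvariance` +
transitivity of the diagonal congruence), lift there (`stub_liftingFlatTarget`), and carry the Satake
conclusion back along the conjugation (`stub_conjInvariance`). -/
theorem EisensteinSeededLifting_of :
    Sig.stub_residualFlattening → Sig.stub_conjInvariance → Sig.stub_liftingFlatTarget →
    Summit.Langlands.Langlands.Theses.EisensteinDegreeShift.EisensteinSeededLifting := by
  intro h1 h2 h3 K _ _ hK n hn p _ hp hur O hO hcpt ι ρ ρ₀ hirr hae hut hFL hseed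
  obtain ⟨P, ρ', ρ₀', hρ', hut', hoff, hdiag⟩ := h1 K n p O hO ρ ρ₀ hut
  obtain ⟨hirrT, hunrT, hHodgeT, hSatT⟩ := h2 K n p hcpt ι ρ ρ' P hρ'
  have hae' : ∀ᶠ v : IsDedekindDomain.HeightOneSpectrum (NumberField.RingOfIntegers K) in Filter.cofinite, ρ'.IsUnramifiedAt v :=
    hae.mono fun v hv => hunrT v hv
  have hFL' : ∀ (v : IsDedekindDomain.HeightOneSpectrum (NumberField.RingOfIntegers K)) (hv : ((p : ℕ) : NumberField.RingOfIntegers K) ∈ v.asIdeal),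
      let D := Literature.NumberTheory.PAdicHodge.fontainePstAdicCompletion v p hv;
      D.IsCrystallineFramed (ρ'.toLocal v) ∧ (letI := D.algebra; ∀ τ : v.adicCompletion K →ₐ[ℚ_[p]] PadicAlgCl p,
        let M := ρ'.labelledHodgeTateWeightsAt v D.algebra D.𝔅 τ.toRingHom;
        M.Nodup ∧ Multiset.card M = n ∧ ∀ a ∈ M, ∀ b ∈ M, a - b ≤ (p : ℤ) - 2) := by
    intro v hv
    letI := (Literature.NumberTheory.PAdicHodge.fontainePstAdicCompletion v p hv).algebra
    obtain ⟨hcr, hwt⟩ := hFL v hv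
    obtain ⟨hcrT, hwtT⟩ := hHodgeT v hv
    refine ⟨hcrT hcr, fun τ => ?_⟩
    have e := hwtT τ.toRingHom
    have w := hwt τ
    rw [e]
    exact w
  have key := h3 K hK n hn p hp hur O hO hcpt ι ρ' ρ₀' (hirrT hirr) hae' hut' hoff hFL'
  obtain ⟨v₀, hv₀p, hunr₀, π₀, ρ₁, ρ₁₀, hLalg, hSat₁, hirr₁, hut₁, hcong, hFL₁, r, hr, hN⟩ := hseed
  have hcong' : ∀ (g : Field.absoluteGaloisGroup K) (i : Fin n), ((ρ₁₀ g).val i i - (ρ₀' g).val i i : O) ∈ IsLocalRing.maximalIdeal O := by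
    intro g i
    have h12 := Ideal.sub_mem _ (hcong g i) (hdiag g i)
    rwa [sub_sub_sub_cancel_right] at h12
  have hFL₁' : ∀ (v : IsDedekindDomain.HeightOneSpectrum (NumberField.RingOfIntegers K)) (hv : ((p : ℕ) : NumberField.RingOfIntegers K) ∈ v.asIdeal),
      let D := Literature.NumberTheory.PAdicHodge.fontainePstAdicCompletion v p hv;
      D.IsCrystallineFramed (ρ₁.toLocal v) ∧ (letI := D.algebra; ∀ τ : v.adicCompletion K →ₐ[ℚ_[p]] PadicAlgCl p,
        ρ₁.labelledHodgeTateWeightsAt v D.algebra D.𝔅 τ.toRingHom = ρ'.labelledHodgeTateWeightsAt v D.algebra D.𝔅 τ.toRingHom) := by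
    intro v hv
    letI := (Literature.NumberTheory.PAdicHodge.fontainePstAdicCompletion v p hv).algebra
    obtain ⟨hcr₁, hwt₁⟩ := hFL₁ v hv
    obtain ⟨-, hwtT⟩ := hHodgeT v hv
    exact ⟨hcr₁, fun τ => (hwt₁ τ).trans (hwtT τ.toRingHom).symm⟩
  obtain ⟨π, hπalg, hπ⟩ :=
    key ⟨v₀, hv₀p, hunrT v₀ hunr₀, π₀, ρ₁, ρ₁₀, hLalg, hSat₁, hirr₁, hut₁, hcong', hFL₁', r, hr, hN⟩
  exact ⟨π, hπalg, hπ.mono fun v hv => hSatT π v hv⟩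

/-- **THE SKELETON THEOREM (registrar shape, D-0027 §3.3).** The crux
`Summit.Langlands.Langlands.Theses.EisensteinDegreeShift.EisensteinSeededLifting` concluded BY NAME from the
three registered stubs through the sorry-free composition `EisensteinSeededLifting_of`; it becomes the crux
proof when the last `stub_*` is discharged (until then it depends on `sorryAx` through the stubs only). -/
theorem EisensteinSeededLifting_proof :
    Summit.Langlands.Langlands.Theses.EisensteinDegreeShift.EisensteinSeededLifting :=
  EisensteinSeededLifting_of stub_residualFlattening stub_conjInvariance stub_liftingFlatTarget

end Summit.Langlands.Langlands.Cruxes.EisensteinSeededLifting.Birth
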